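import Summits.RiemannHypothesis.RiemannHypothesis.Theses.LiDirichletEcho
import Summits.RiemannHypothesis.RiemannHypothesis.Theorems.LiDirichletEchoLiPrimeEdgeEchoChar
import Summits.RiemannHypothesis.RiemannHypothesis.Theorems.LiDirichletEchoLiWindowContourChar
import Summits.RiemannHypothesis.RiemannHypothesis.Theorems.LiDirichletEchoLiGammaShiftChar
import Summits.RiemannHypothesis.RiemannHypothesis.Theorems.LiDirichletEchoLiHorizontalEdgesChar
import Summits.RiemannHypothesis.RiemannHypothesis.Theorems.LiDirichletEchoAssembly
import HarnessLib

/-!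
# RiemannHypothesis / LiDirichletEcho — CAPSTONE: the Li prime-echo law for Dirichlet characters is a theorem
# (RH-FREE, GRH-FREE)

RH-FREE · GRH-FREE [rh-li-eng g5, acting as prover on the unstaffed route].  Route `Theses/LiDirichletEcho.lean` (rung
«Li PRIME-ECHO LAW FOR DIRICHLET CHARACTERS» L-P(P1χ), cell `pub/rh-li`): the route's `closes` composition applied to the
five landed binders — `liPrimeEdgeEchoChar_proof` (K2χ, the twisted echo of the prime 2 by the COMPLEX stationary phase),
`liWindowContourChar_proof` (K1χ, Bombieri's rectangle for `ξ(·, χ)` with the conjugation fold), `liGammaShiftChar_proof`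
(K4χ), `liHorizontalEdgesChar_proof` (K3χ), `liDirichletEcho_assembly_proof` (Assembly, with the supports
`charWindowAdjust_proof`, `charWindowConj_proof`) — gives the LEAF

  `LiTheory.LiZeroWindowEchoDirichlet`: for every primitive character `χ` mod `q > 1` and `c ≥ 5/4` there is `C` with
  `|charZeroTraceWindow χ n √n (c√n) − charSmoothTraceWindow χ n √n (c√n) + Re χ(2) · liPrimeEcho 2 n| ≤ C log² n` (`n ≥ 2`):
  the zeros of `L(s, χ)` in the window `√n < |Im ρ| ≤ c√n`, weighted by `Re (1 − 1/ρ)ⁿ` and counted with multiplicity at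
  ANY real part, differ from the character's Riemann–von Mangoldt mean by exactly `−Re χ(2)` times the ECHO of the prime
  2, `E₂(n) = A₂ n^{1/4} cos(2√(n log 2) + π/4)`, up to `O_{χ,c}(log² n)`,

and its typed corollaries `LiZeroWindowSilentDirichlet` (even modulus ⇒ silent window).  The cell's certified data rows
(DATA.md §I/§N/§P: seven real and complex characters, `n ≤ 1.6·10⁷`) are instances.  Unconditional: no hypothesis on
the real parts of the zeros of `L(s, χ)` (nor of `ζ`) enters; nothing here bears on the truth of RH or GRH.
-/

noncomputable section

-- D-0017: `Summit.<S>.<S>.…` is the designed namespace of a single-problem summit.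
set_option linter.dupNamespace false

namespace Summit.RiemannHypothesis.RiemannHypothesis.Theorems.LiTheory

open Summit.RiemannHypothesis.RiemannHypothesis.Theses.LiDirichletEcho in
/-- **The Li prime-echo law for Dirichlet characters (LEAF of route `LiDirichletEcho`; RH-FREE, GRH-FREE).**
`LiZeroWindowEchoDirichlet` is a theorem: the route's `closes` applied to the five landed binders. -/
theorem liZeroWindowEchoDirichlet_proof : LiZeroWindowEchoDirichlet :=
  closes liPrimeEdgeEchoChar_proof liWindowContourChar_proof liGammaShiftChar_proof liHorizontalEdgesChar_proof
    liDirichletEcho_assembly_proof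

/-- **Corollary** (RH-FREE, GRH-FREE): `LiZeroWindowSilentDirichlet` holds — a primitive character with `χ(2) = 0` (every
even modulus) has a SILENT `√n`-window: `|Z − S| ≤ C log² n`. -/
theorem liZeroWindowSilentDirichlet_holds : LiZeroWindowSilentDirichlet :=
  liZeroWindowSilentDirichlet_of liZeroWindowEchoDirichlet_proof

end Summit.RiemannHypothesis.RiemannHypothesis.Theorems.LiTheory
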